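/-
Copyright (c) 2026 the pub-hodgecm-mathlib formalisation cell (harness21).  Prover seat hodgecm-mathlib-LH1-p03 (g5): line LH3 (closer stub `stub_N9`), letter L1
clause (I₃) ALL ORDERS, brick (B-desc-R) «wall-factor calculus» (LH3-plan (g3) 2026-09-02T10:06:21Z re-point; LH3-p04 (g4) «hands» 10:07:40Z with the signatures); 2026-09-02.
-/
import Literature.NumberTheory.Rogawski1990.ArchOrbFamGExtJumpWall   -- ★ (c-wall) (LH5-p03 (g2)): `archERhoG_mul_archRG_add_smul_hcNrm_eq`, `tendsto_wallFactorR_nhds_zero`, `wallFactorLimit_ne_zero_of_hcSemireg`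
import Mathlib.Analysis.SpecialFunctions.ExpDeriv                     -- `ContDiff.cexp`
import HarnessLib

/-!
# The wall factor `R(ν)` of the compact `G′`-chart along the wall normal is SMOOTH, with `R(0) = r ≠ 0` at a semiregular point (Shelstad 1979 §4; Rogawski 1990 §8.2)

Topic `NumberTheory/Rogawski1990`; namespace `Literature.NumberTheory.Rogawski1990`.  THEOREMS ONLY (no definition, no instance, no notation, no axiom, no named fact, no
`sorry`); group-free and measure-free (an index type `W` of places, as ★ `ArchOrbFamGExtJumpWall`); kernel lane `--kind proof --supports stmt-HodgeConjecture-24833`.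
Cell `pub/hodgecm-mathlib` (D-0151), crux H413 = `stmt-HodgeConjecture-24833`, F0∕P3c line LH3 (closer stub `stub_N9`, DIRECT ROAD `F0_P3c_StubN9Direct`), letter L1
`HcOrbitalFamiliesStatement`, clause (I₃) `ArchHcJump` AT ALL ORDERS (LH3-plan (g3) RULING #14, F0P3a-p08 (g23) SPEC-I3 v1 2c6e00a0c14eef8d): brick **(B-desc-R)** — the
«wall-factor calculus» consumed by (B-desc) (LH3-p04 (g4), the smooth descent identity `e^{ρ}·R′·orbFamGExt = m(ν)·F_{f♭}(ν)` near a semiregular point) and by (B-norm)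
(LH5-p03 (g3), Leibniz over the ★ (ELL-∞) all-orders rank-one jumps): at order `0` the ★ shell `ArchOrbFamGExtJumpOfBricks` (p850303) only needed `Tendsto R (𝓝 0) (𝓝 r)`,
`r ≠ 0` (★ (c-wall) `exists_wallFactor_archERhoG_mul_archRG_of_hcSemireg`); at order `n` the Leibniz expansion of `iteratedDeriv n (ν ↦ R ν * Φ ν)` reads the JETS
`iteratedDeriv j R 0`, so `R` must be `C^∞` through the wall.  HONEST LABEL: HC_CM is proved only modulo the 7 printed citations (2 remaining named inputs: hLiu418 =
`stmt-HodgeConjecture-24832`, h413 = `stmt-HodgeConjecture-24833`) until rung 0 closes; count-neutral one-variable calculus (no stub closes by this file alone).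

THE MATHEMATICS.  On the compact `G′`-chart `S` (`w ∉ S`) at a wall point `p` (`p w 0 = p w 2 = θ`, `φ = p w 1`), along the normal `p + ν·n`, `n = hcNrm w 0 2`, ★ (c-wall)
factorises the `ρ`-twisted normaliser as `e^{ρ}·R′(p + ν·n) = 2 sin ν · R(ν)` with the EXPLICIT
  `R(ν) = i · e^{iν}(1 − e^{i(φ−θ−ν)})(1 − e^{i(θ−ν−φ)}) · P`,  `P = ∏_{w′ ≠ w}`(frozen factors at `p`, no `ν`).
Each moving factor is `cexp` of a real-affine function of `ν` times `i` (`(Circle.exp t : ℂ) = cexp (t·i)`, ★ `Circle.coe_exp`), so `R` is `C^∞` on `ℝ` (indeed real-analytic: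
`e^{iν}(1 − e^{i(φ−θ−ν)})(1 − e^{i(θ−ν−φ)}) = 2cos ν − 2cos(φ−θ)`, the compact real form of the `Ad(M)`-invariant cofactor `tr − 2cos δ` of SPEC-I3 (S1)); by continuity and
★ `tendsto_wallFactorR_nhds_zero`, `R(0) = r = i·|e^{iθ} − e^{iφ}|²·P` (uniqueness of limits — no trigonometric algebra), and `r ≠ 0` at a SEMIREGULAR wall point (★
`wallFactorLimit_ne_zero_of_hcSemireg`).

WHAT IS PROVED.
* §1 `contDiff_coe_circleExp_comp`, `contDiff_coe_circleExp` (the moving factor shape `cexp (f ν · i)`, `f` real-affine), **`contDiff_wallFactorR`** (R1): `ContDiff ℝ ∞ R`, `R` = ★ :54's right factor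
  VERBATIM as a function of `ν`.
* §2 **`wallFactorR_zero_eq`** (`R 0 = r`, `r` = ★ `tendsto_wallFactorR_nhds_zero`'s limit VERBATIM) and **`wallFactorR_zero_ne_zero_of_hcSemireg`** (R2).
* §3 **`exists_contDiff_wallFactor_archERhoG_mul_archRG_of_hcSemireg`** (R3, LH3-p04 (g4)'s consumer text token for token):
  `∃ R : ℝ → ℂ, ContDiff ℝ ∞ R ∧ R 0 ≠ 0 ∧ ∀ ν, archERhoG S (p + ν • hcNrm w 0 2) * archRG S (p + ν • hcNrm w 0 2) = (2 * Real.sin ν : ℂ) * R ν`,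
  and the explicit-value twin `exists_contDiff_wallFactor_archERhoG_mul_archRG_eq` (`… ∧ R 0 = r ∧ …` with `r` written out, for the closed term of `jc′` in (B-jc)).
* §4 (ED. 2, R4) `contDiff_coe_circleExp_comp_of_contDiff`, `contDiffAt_coe_splitFrozenFactor`, `isOpen_setOf_forall_mem_snd_apply_ne_zero`,
  **`contDiffOn_wallFactorR_uncurry`** (`R` jointly `C^∞` in `q = (ν, p)` on the open carrier `{q | ∀ w′ ∈ S, w′ ≠ w → q.2 w′ 0 ≠ 0}`) and
  **`contDiffAt_wallFactorR_uncurry_of_hcSemireg`** (`C^∞` at `(ν, p)` for every `ν` when `p` is semiregular) — the product-neighbourhood form of RULING #15.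

## References
* [Shelstad1979] D. Shelstad, *Characters and inner forms of a quasi-split group over ℝ*, Compositio Math. 39 (1979), §4 pp. 22–26 (Lemma 4.3 p. 25, Prop. 4.5 p. 26: the
  jump of every `∂(u)Ψ^T_f` across a noncompact wall, the cofactor of the other roots being smooth through the wall).
* [Rogawski1990] J. D. Rogawski, *Automorphic Representations of Unitary Groups in Three Variables*, Ann. of Math. Stud. 123 (1990), §8.2 pp. 118–124 (p. 122: the curve
  `(θ+ψ, θ₁, θ−ψ)` and the factor `2i sin ψ`).
* [Varadarajan1989] V. S. Varadarajan, *An Introduction to Harmonic Analysis on Semisimple Lie Groups* (1989), §6.4 Thm 24 (all orders at the wall).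
-/

set_option autoImplicit false

noncomputable section

open Complex Set Function Real Filter Topology
open Literature.NumberTheory.Automorphic.ArchCartan
open scoped ContDiff

namespace Literature.NumberTheory.Rogawski1990

variable {W : Type*} [Fintype W] [DecidableEq W]

/-! ## §1 Smoothness of the wall factor `R` in the normal variable -/

/-- For a smooth real function `f`, `ν ↦ (Circle.exp (f ν) : ℂ) = cexp (f ν · i)` is `C^∞` on `ℝ` (the shape of every moving root factor of `R`: `e^{iν}`,
`1 − e^{i(φ−θ−ν)}`, `1 − e^{i(θ−ν−φ)}`). [cite: Rogawski1990, §8.2 p. 122] -/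
theorem contDiff_coe_circleExp_comp {f : ℝ → ℝ} (hf : ContDiff ℝ ∞ f) : ContDiff ℝ ∞ (fun ν : ℝ => (Circle.exp (f ν) : ℂ)) := by
  have h : (fun ν : ℝ => (Circle.exp (f ν) : ℂ)) = fun ν : ℝ => Complex.exp (((f ν : ℝ) : ℂ) * I) := funext fun ν => Circle.coe_exp (f ν)
  rw [h]
  exact ((Complex.ofRealCLM.contDiff.comp hf).mul contDiff_const).cexp

/-- `ν ↦ (Circle.exp ν : ℂ)` is `C^∞` on `ℝ`. [cite: Rogawski1990, §8.2 p. 122] -/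
theorem contDiff_coe_circleExp : ContDiff ℝ ∞ (fun ν : ℝ => (Circle.exp ν : ℂ)) :=
  contDiff_coe_circleExp_comp contDiff_id

/-- **(R1) THE WALL FACTOR IS SMOOTH THROUGH THE WALL**: the explicit `R(ν) = i·e^{iν}(1 − e^{i(φ−θ−ν)})(1 − e^{i(θ−ν−φ)})·∏_{w′ ≠ w}(frozen factors at p)` of ★ (c-wall)
`archERhoG_mul_archRG_add_smul_hcNrm_eq` (its right factor VERBATIM, as a function of `ν`) is `ContDiff ℝ ∞` — a finite product of `cexp` of real-affine functions of `ν` and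
of `ν`-free constants.  This is what lets the Leibniz expansion of the order-`n` twisted normal derivative read the jets `iteratedDeriv j R 0` ((B-norm)).
[cite: Shelstad1979, Lemma 4.3 (p. 25); Prop. 4.5 (p. 26)] [cite: Rogawski1990, §8.2 p. 122] [cite: Varadarajan1989, §6.4 Thm 24] -/
theorem contDiff_wallFactorR (S : Finset W) (w : W) (p : W → Fin 3 → ℝ) :
    ContDiff ℝ ∞ (fun ν : ℝ =>
      I * ((Circle.exp ν : ℂ) * ((1 - (Circle.exp (p w 1 - p w 0 - ν) : ℂ)) * (1 - (Circle.exp (p w 0 - ν - p w 1) : ℂ)))) *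
        ∏ w' ∈ Finset.univ.erase w,
          ((if w' ∈ S then (1 : ℂ) else (Circle.exp (p w' 0 - p w' 2) : ℂ)) *
            (if w' ∈ S then
                ((|Real.exp (p w' 0) - Real.exp (-p w' 0)| *
                  ‖Complex.exp (p w' 0 + p w' 2 * I) - Complex.exp (p w' 1 * I)‖ * ‖Complex.exp (-p w' 0 + p w' 2 * I) - Complex.exp (p w' 1 * I)‖ : ℝ) : ℂ)
              else (1 - (Circle.exp (p w' 1 - p w' 0) : ℂ)) * (1 - (Circle.exp (p w' 2 - p w' 0) : ℂ)) * (1 - (Circle.exp (p w' 2 - p w' 1) : ℂ))))) := by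
  refine (contDiff_const.mul (contDiff_coe_circleExp.mul ?_)).mul contDiff_const
  exact (contDiff_const.sub (contDiff_coe_circleExp_comp (contDiff_const.sub contDiff_id))).mul
    (contDiff_const.sub (contDiff_coe_circleExp_comp ((contDiff_const.sub contDiff_id).sub contDiff_const)))

/-! ## §2 The value at the wall: `R 0 = r`, non-zero at a semiregular point -/

/-- **`R(0) = r = i·|e^{iθ} − e^{iφ}|²·∏_{w′ ≠ w}(frozen factors)`** — by continuity of `R` (§1) and ★ `tendsto_wallFactorR_nhds_zero`, uniqueness of limits in `ℂ` (no
trigonometric algebra). [cite: Rogawski1990, §8.2 p. 122] [cite: Shelstad1979, §4 p. 25] -/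
theorem wallFactorR_zero_eq (S : Finset W) (w : W) (p : W → Fin 3 → ℝ) :
    I * ((Circle.exp (0 : ℝ) : ℂ) * ((1 - (Circle.exp (p w 1 - p w 0 - 0) : ℂ)) * (1 - (Circle.exp (p w 0 - 0 - p w 1) : ℂ)))) *
        ∏ w' ∈ Finset.univ.erase w,
          ((if w' ∈ S then (1 : ℂ) else (Circle.exp (p w' 0 - p w' 2) : ℂ)) *
            (if w' ∈ S then
                ((|Real.exp (p w' 0) - Real.exp (-p w' 0)| *
                  ‖Complex.exp (p w' 0 + p w' 2 * I) - Complex.exp (p w' 1 * I)‖ * ‖Complex.exp (-p w' 0 + p w' 2 * I) - Complex.exp (p w' 1 * I)‖ : ℝ) : ℂ)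
              else (1 - (Circle.exp (p w' 1 - p w' 0) : ℂ)) * (1 - (Circle.exp (p w' 2 - p w' 0) : ℂ)) * (1 - (Circle.exp (p w' 2 - p w' 1) : ℂ)))) =
      I * (((‖(Circle.exp (p w 0) : ℂ) - Circle.exp (p w 1)‖ ^ 2 : ℝ)) : ℂ) *
        ∏ w' ∈ Finset.univ.erase w,
          ((if w' ∈ S then (1 : ℂ) else (Circle.exp (p w' 0 - p w' 2) : ℂ)) *
            (if w' ∈ S then
                ((|Real.exp (p w' 0) - Real.exp (-p w' 0)| *
                  ‖Complex.exp (p w' 0 + p w' 2 * I) - Complex.exp (p w' 1 * I)‖ * ‖Complex.exp (-p w' 0 + p w' 2 * I) - Complex.exp (p w' 1 * I)‖ : ℝ) : ℂ)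
              else (1 - (Circle.exp (p w' 1 - p w' 0) : ℂ)) * (1 - (Circle.exp (p w' 2 - p w' 0) : ℂ)) * (1 - (Circle.exp (p w' 2 - p w' 1) : ℂ)))) := by
  have hcont := (contDiff_wallFactorR S w p).continuous.tendsto (0 : ℝ)
  exact tendsto_nhds_unique hcont (tendsto_wallFactorR_nhds_zero S w p)

/-- **(R2) `R(0) ≠ 0` AT A SEMIREGULAR WALL POINT** (`R 0 = r` by §2 and `r ≠ 0` by ★ `wallFactorLimit_ne_zero_of_hcSemireg`: `e^{iφ} ≠ e^{iθ}` and `G′`-regularity at every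
`w′ ≠ w`). [cite: Shelstad1979, §4 p. 22; Prop. 4.5 (p. 26)] [cite: Rogawski1990, §8.2 p. 122] -/
theorem wallFactorR_zero_ne_zero_of_hcSemireg (S : Finset W) {w : W} {p : W → Fin 3 → ℝ} (hp : HcSemireg S w 0 2 p) :
    I * ((Circle.exp (0 : ℝ) : ℂ) * ((1 - (Circle.exp (p w 1 - p w 0 - 0) : ℂ)) * (1 - (Circle.exp (p w 0 - 0 - p w 1) : ℂ)))) *
        ∏ w' ∈ Finset.univ.erase w,
          ((if w' ∈ S then (1 : ℂ) else (Circle.exp (p w' 0 - p w' 2) : ℂ)) *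
            (if w' ∈ S then
                ((|Real.exp (p w' 0) - Real.exp (-p w' 0)| *
                  ‖Complex.exp (p w' 0 + p w' 2 * I) - Complex.exp (p w' 1 * I)‖ * ‖Complex.exp (-p w' 0 + p w' 2 * I) - Complex.exp (p w' 1 * I)‖ : ℝ) : ℂ)
              else (1 - (Circle.exp (p w' 1 - p w' 0) : ℂ)) * (1 - (Circle.exp (p w' 2 - p w' 0) : ℂ)) * (1 - (Circle.exp (p w' 2 - p w' 1) : ℂ)))) ≠ 0 := by
  rw [wallFactorR_zero_eq S w p]
  exact wallFactorLimit_ne_zero_of_hcSemireg S hp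

/-! ## §3 The packages consumed by (B-desc) ∕ (B-norm) -/

/-- **(R3) THE SMOOTH WALL-FACTOR PACKAGE AT A SEMIREGULAR WALL POINT** (LH3-p04 (g4)'s consumer text): for `w ∉ S` and `p` semiregular on the wall `(w, 0, 2)`,
`∃ R : ℝ → ℂ, ContDiff ℝ ∞ R ∧ R 0 ≠ 0 ∧ ∀ ν, e^{ρ}·R′(p + ν·hcNrm w 0 2) = (2 sin ν)·R ν` — ★ (c-wall) `exists_wallFactor_archERhoG_mul_archRG_of_hcSemireg` with
`Tendsto R (𝓝 0) (𝓝 r) ∧ r ≠ 0` upgraded to `ContDiff ℝ ∞ R ∧ R 0 ≠ 0`. [cite: Shelstad1979, Lemma 4.3 (p. 25); Prop. 4.5 (p. 26)] [cite: Rogawski1990, §8.2 pp. 122–124]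
[cite: Varadarajan1989, §6.4 Thm 24] -/
theorem exists_contDiff_wallFactor_archERhoG_mul_archRG_of_hcSemireg (S : Finset W) {w : W} (hw : w ∉ S) {p : W → Fin 3 → ℝ} (hp : HcSemireg S w 0 2 p) :
    ∃ R : ℝ → ℂ, ContDiff ℝ ∞ R ∧ R 0 ≠ 0 ∧
      ∀ ν : ℝ, archERhoG S (p + ν • hcNrm w 0 2) * archRG S (p + ν • hcNrm w 0 2) = (2 * Real.sin ν : ℂ) * R ν :=
  ⟨_, contDiff_wallFactorR S w p, wallFactorR_zero_ne_zero_of_hcSemireg S hp, archERhoG_mul_archRG_add_smul_hcNrm_eq S hw hp.1⟩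

/-- **(R3′) THE SAME PACKAGE WITH THE VALUE AT THE WALL WRITTEN OUT** (for the closed term of the jump constant `jc′` in (B-jc)): for `w ∉ S` and `p` on the wall
`p w 0 = p w 2`, `∃ R, ContDiff ℝ ∞ R ∧ R 0 = i·|e^{iθ} − e^{iφ}|²·∏_{w′ ≠ w}(frozen factors) ∧ ∀ ν, e^{ρ}·R′(p + ν·hcNrm w 0 2) = (2 sin ν)·R ν`.
[cite: Shelstad1979, Lemma 4.3 (p. 25)] [cite: Rogawski1990, §8.2 p. 122] -/
theorem exists_contDiff_wallFactor_archERhoG_mul_archRG_eq (S : Finset W) {w : W} (hw : w ∉ S) {p : W → Fin 3 → ℝ} (hp : p w 0 = p w 2) :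
    ∃ R : ℝ → ℂ, ContDiff ℝ ∞ R ∧
      R 0 = I * (((‖(Circle.exp (p w 0) : ℂ) - Circle.exp (p w 1)‖ ^ 2 : ℝ)) : ℂ) *
        ∏ w' ∈ Finset.univ.erase w,
          ((if w' ∈ S then (1 : ℂ) else (Circle.exp (p w' 0 - p w' 2) : ℂ)) *
            (if w' ∈ S then
                ((|Real.exp (p w' 0) - Real.exp (-p w' 0)| *
                  ‖Complex.exp (p w' 0 + p w' 2 * I) - Complex.exp (p w' 1 * I)‖ * ‖Complex.exp (-p w' 0 + p w' 2 * I) - Complex.exp (p w' 1 * I)‖ : ℝ) : ℂ)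
              else (1 - (Circle.exp (p w' 1 - p w' 0) : ℂ)) * (1 - (Circle.exp (p w' 2 - p w' 0) : ℂ)) * (1 - (Circle.exp (p w' 2 - p w' 1) : ℂ)))) ∧
      ∀ ν : ℝ, archERhoG S (p + ν • hcNrm w 0 2) * archRG S (p + ν • hcNrm w 0 2) = (2 * Real.sin ν : ℂ) * R ν :=
  ⟨_, contDiff_wallFactorR S w p, wallFactorR_zero_eq S w p, archERhoG_mul_archRG_add_smul_hcNrm_eq S hw hp⟩

/-! ## §4 (R4, ED. 2) The product-neighbourhood edition: `R` is jointly smooth in `(ν, p)` off the split-place loci `x_{w′} = 0`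

RULING #15 (LH3-plan (g3)) binds (B-desc) ED. 2 to a PRODUCT NEIGHBOURHOOD `(ν, p)` of a semiregular wall point; the wall factor read as a function of
`q = (ν, p) : ℝ × (W → Fin 3 → ℝ)` (the §1 expression with `p := q.2`, `ν := q.1` — definitionally `R_{q.2}(q.1)`) is `C^∞` on the OPEN set
`{q | ∀ w′ ∈ S, w′ ≠ w → q.2 w′ 0 ≠ 0}`: the moving factors and the compact-place frozen factors are `cexp` of real-linear forms (smooth everywhere), while a split place
`w′ ∈ S` contributes `|e^{x} − e^{−x}|·‖e^{x+iθ₂} − e^{iθ₁}‖·‖e^{−x+iθ₂} − e^{iθ₁}‖` (`x = q.2 w′ 0`), smooth exactly where the three factors do not vanish, i.e. off `x = 0`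
(★ `abs_exp_sub_exp_neg_ne_zero_iff`, ★ `norm_exp_add_mul_I_sub_exp_mul_I_ne_zero`; Mathlib `ContDiffAt.abs`, `ContDiffAt.norm`).  A semiregular `p` (★ `HcSemireg S w 0 2 p`:
`p w′ 0 ≠ 0` at every `w′ ∈ S`) lies in the carrier with every `ν`. -/

section Joint

variable {E : Type*} [NormedAddCommGroup E] [NormedSpace ℝ E]

/-- For a smooth real function `f` on any real normed space, `x ↦ (Circle.exp (f x) : ℂ) = cexp (f x · i)` is `C^∞` (§1's shape lemma with a general source).
[cite: Rogawski1990, §8.2 p. 122] -/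
theorem contDiff_coe_circleExp_comp_of_contDiff {f : E → ℝ} (hf : ContDiff ℝ ∞ f) : ContDiff ℝ ∞ (fun x : E => (Circle.exp (f x) : ℂ)) := by
  have h : (fun x : E => (Circle.exp (f x) : ℂ)) = fun x : E => Complex.exp (((f x : ℝ) : ℂ) * I) := funext fun x => Circle.coe_exp (f x)
  rw [h]
  exact ((Complex.ofRealCLM.contDiff.comp hf).mul contDiff_const).cexp

/-- **The split-place frozen factor is smooth off `x = 0`**: for smooth real `f, g, h` and a point with `f x ≠ 0`,
`y ↦ ↑(|e^{f y} − e^{−f y}| · ‖e^{f y + i g y} − e^{i h y}‖ · ‖e^{−f y + i g y} − e^{i h y}‖)` is `C^∞` at `x` (each factor is non-zero there: ★ `abs_exp_sub_exp_neg_ne_zero_iff`,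
★ `norm_exp_add_mul_I_sub_exp_mul_I_ne_zero`). [cite: Shelstad1979, §4 p. 22] [cite: Rogawski1990, §8.2 p. 118] -/
theorem contDiffAt_coe_splitFrozenFactor {f g h : E → ℝ} (hf : ContDiff ℝ ∞ f) (hg : ContDiff ℝ ∞ g) (hh : ContDiff ℝ ∞ h) {x : E} (hx : f x ≠ 0) :
    ContDiffAt ℝ ∞ (fun y : E =>
      ((|Real.exp (f y) - Real.exp (-f y)| *
        ‖Complex.exp (f y + g y * I) - Complex.exp (h y * I)‖ * ‖Complex.exp (-f y + g y * I) - Complex.exp (h y * I)‖ : ℝ) : ℂ)) x := by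
  have hF : ContDiff ℝ ∞ fun y : E => ((f y : ℝ) : ℂ) := Complex.ofRealCLM.contDiff.comp hf
  have hG : ContDiff ℝ ∞ fun y : E => ((g y : ℝ) : ℂ) := Complex.ofRealCLM.contDiff.comp hg
  have hH : ContDiff ℝ ∞ fun y : E => ((h y : ℝ) : ℂ) := Complex.ofRealCLM.contDiff.comp hh
  have h1 : ContDiffAt ℝ ∞ (fun y : E => |Real.exp (f y) - Real.exp (-f y)|) x := by
    have h1' : ContDiffAt ℝ ∞ (fun y : E => ‖Real.exp (f y) - Real.exp (-f y)‖) x :=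
      ((Real.contDiff_exp.comp hf).sub (Real.contDiff_exp.comp hf.neg)).contDiffAt.norm ℝ
        (abs_ne_zero.1 ((abs_exp_sub_exp_neg_ne_zero_iff (f x)).2 hx))
    simpa only [Real.norm_eq_abs] using h1'
  have h2 : ContDiffAt ℝ ∞ (fun y : E => ‖Complex.exp (f y + g y * I) - Complex.exp (h y * I)‖) x :=
    ((hF.add (hG.mul contDiff_const)).cexp.sub (hH.mul contDiff_const).cexp).contDiffAt.norm ℝ
      (norm_ne_zero_iff.1 (norm_exp_add_mul_I_sub_exp_mul_I_ne_zero hx (g x) (h x)))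
  have h3 : ContDiffAt ℝ ∞ (fun y : E => ‖Complex.exp (-f y + g y * I) - Complex.exp (h y * I)‖) x := by
    have hx' : -f x ≠ 0 := neg_ne_zero.2 hx
    have h0 : ‖Complex.exp (-(f x : ℂ) + g x * I) - Complex.exp (h x * I)‖ ≠ 0 := by
      simpa only [Complex.ofReal_neg] using norm_exp_add_mul_I_sub_exp_mul_I_ne_zero hx' (g x) (h x)
    exact ((hF.neg.add (hG.mul contDiff_const)).cexp.sub (hH.mul contDiff_const).cexp).contDiffAt.norm ℝ (norm_ne_zero_iff.1 h0)
  exact Complex.ofRealCLM.contDiff.contDiffAt.comp x ((h1.mul h2).mul h3)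

omit [Fintype W] [DecidableEq W] in
/-- The carrier `{q | ∀ w′ ∈ S, w′ ≠ w → q.2 w′ 0 ≠ 0}` of the joint wall factor is OPEN (finitely many continuous coordinate conditions). [cite: Shelstad1979, §4 p. 22] -/
theorem isOpen_setOf_forall_mem_snd_apply_ne_zero (S : Finset W) (w : W) :
    IsOpen {q : ℝ × (W → Fin 3 → ℝ) | ∀ w' ∈ S, w' ≠ w → q.2 w' 0 ≠ 0} := by
  have h : {q : ℝ × (W → Fin 3 → ℝ) | ∀ w' ∈ S, w' ≠ w → q.2 w' 0 ≠ 0} =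
      ⋂ w' ∈ S, {q : ℝ × (W → Fin 3 → ℝ) | w' ≠ w → q.2 w' 0 ≠ 0} := by
    ext q; simp only [mem_setOf_eq, mem_iInter]
  rw [h]
  refine isOpen_biInter_finset fun w' _ => ?_
  by_cases hw' : w' = w
  · have : {q : ℝ × (W → Fin 3 → ℝ) | w' ≠ w → q.2 w' 0 ≠ 0} = univ := eq_univ_of_forall fun q h' => absurd hw' h'
    rw [this]; exact isOpen_univ
  · have : {q : ℝ × (W → Fin 3 → ℝ) | w' ≠ w → q.2 w' 0 ≠ 0} = (fun q : ℝ × (W → Fin 3 → ℝ) => q.2 w' 0) ⁻¹' {0}ᶜ := by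
      ext q; simp only [mem_setOf_eq, mem_preimage, mem_compl_iff, mem_singleton_iff]; exact ⟨fun h' => h' hw', fun h' _ => h'⟩
    rw [this]
    exact isOpen_compl_singleton.preimage ((continuous_apply (0 : Fin 3)).comp ((continuous_apply w').comp continuous_snd))

/-- **(R4) THE WALL FACTOR IS JOINTLY SMOOTH IN `(ν, p)` on `{q | ∀ w′ ∈ S, w′ ≠ w → q.2 w′ 0 ≠ 0}`** — the §1 expression read at `p := q.2`, `ν := q.1` (definitionally
`R_{q.2}(q.1)`): the moving factors and the compact-place frozen factors are `cexp` of real-linear forms of `q`; the split-place frozen factors are smooth off `x_{w′} = 0` (§4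
`contDiffAt_coe_splitFrozenFactor`).  The product-neighbourhood form RULING #15 asks of (B-desc) ED. 2. [cite: Shelstad1979, Lemma 4.3 (p. 25); Prop. 4.5 (p. 26)]
[cite: Rogawski1990, §8.2 pp. 118–124] [cite: Varadarajan1989, §6.4 Thm 24] -/
theorem contDiffOn_wallFactorR_uncurry (S : Finset W) (w : W) :
    ContDiffOn ℝ ∞ (fun q : ℝ × (W → Fin 3 → ℝ) =>
      I * ((Circle.exp q.1 : ℂ) * ((1 - (Circle.exp (q.2 w 1 - q.2 w 0 - q.1) : ℂ)) * (1 - (Circle.exp (q.2 w 0 - q.1 - q.2 w 1) : ℂ)))) *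
        ∏ w' ∈ Finset.univ.erase w,
          ((if w' ∈ S then (1 : ℂ) else (Circle.exp (q.2 w' 0 - q.2 w' 2) : ℂ)) *
            (if w' ∈ S then
                ((|Real.exp (q.2 w' 0) - Real.exp (-q.2 w' 0)| *
                  ‖Complex.exp (q.2 w' 0 + q.2 w' 2 * I) - Complex.exp (q.2 w' 1 * I)‖ * ‖Complex.exp (-q.2 w' 0 + q.2 w' 2 * I) - Complex.exp (q.2 w' 1 * I)‖ : ℝ) : ℂ)
              else (1 - (Circle.exp (q.2 w' 1 - q.2 w' 0) : ℂ)) * (1 - (Circle.exp (q.2 w' 2 - q.2 w' 0) : ℂ)) * (1 - (Circle.exp (q.2 w' 2 - q.2 w' 1) : ℂ)))))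
      {q | ∀ w' ∈ S, w' ≠ w → q.2 w' 0 ≠ 0} := by
  -- the coordinates of `q` are smooth
  have hc : ∀ (w' : W) (l : Fin 3), ContDiff ℝ ∞ fun q : ℝ × (W → Fin 3 → ℝ) => q.2 w' l := fun w' l =>
    (contDiff_apply_apply (𝕜 := ℝ) (E := ℝ) w' l).comp contDiff_snd
  have hν : ContDiff ℝ ∞ fun q : ℝ × (W → Fin 3 → ℝ) => q.1 := contDiff_fst
  intro q hq
  refine ContDiffAt.contDiffWithinAt ?_
  refine (contDiff_const.mul ((contDiff_coe_circleExp_comp_of_contDiff hν).mul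
    ((contDiff_const.sub (contDiff_coe_circleExp_comp_of_contDiff (((hc w 1).sub (hc w 0)).sub hν))).mul
      (contDiff_const.sub (contDiff_coe_circleExp_comp_of_contDiff (((hc w 0).sub hν).sub (hc w 1))))))).contDiffAt.mul ?_
  refine contDiffAt_prod fun w' hw' => ?_
  have hne : w' ≠ w := Finset.ne_of_mem_erase hw'
  by_cases hS : w' ∈ S
  · simp only [if_pos hS]
    exact contDiffAt_const.mul (contDiffAt_coe_splitFrozenFactor (hc w' 0) (hc w' 2) (hc w' 1) (hq w' hS hne))
  · simp only [if_neg hS]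
    exact ((contDiff_coe_circleExp_comp_of_contDiff ((hc w' 0).sub (hc w' 2))).mul
      (((contDiff_const.sub (contDiff_coe_circleExp_comp_of_contDiff ((hc w' 1).sub (hc w' 0)))).mul
        (contDiff_const.sub (contDiff_coe_circleExp_comp_of_contDiff ((hc w' 2).sub (hc w' 0))))).mul
        (contDiff_const.sub (contDiff_coe_circleExp_comp_of_contDiff ((hc w' 2).sub (hc w' 1)))))).contDiffAt

/-- **(R4′) AT A SEMIREGULAR WALL POINT the joint wall factor is `C^∞` at `(ν, p)` for EVERY `ν`** (★ `HcSemireg S w 0 2 p` puts `p` in the open carrier of (R4)).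
[cite: Shelstad1979, Prop. 4.5 (p. 26)] [cite: Rogawski1990, §8.2 pp. 122–124] -/
theorem contDiffAt_wallFactorR_uncurry_of_hcSemireg (S : Finset W) {w : W} {p : W → Fin 3 → ℝ} (hp : HcSemireg S w 0 2 p) (ν : ℝ) :
    ContDiffAt ℝ ∞ (fun q : ℝ × (W → Fin 3 → ℝ) =>
      I * ((Circle.exp q.1 : ℂ) * ((1 - (Circle.exp (q.2 w 1 - q.2 w 0 - q.1) : ℂ)) * (1 - (Circle.exp (q.2 w 0 - q.1 - q.2 w 1) : ℂ)))) *
        ∏ w' ∈ Finset.univ.erase w,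
          ((if w' ∈ S then (1 : ℂ) else (Circle.exp (q.2 w' 0 - q.2 w' 2) : ℂ)) *
            (if w' ∈ S then
                ((|Real.exp (q.2 w' 0) - Real.exp (-q.2 w' 0)| *
                  ‖Complex.exp (q.2 w' 0 + q.2 w' 2 * I) - Complex.exp (q.2 w' 1 * I)‖ * ‖Complex.exp (-q.2 w' 0 + q.2 w' 2 * I) - Complex.exp (q.2 w' 1 * I)‖ : ℝ) : ℂ)
              else (1 - (Circle.exp (q.2 w' 1 - q.2 w' 0) : ℂ)) * (1 - (Circle.exp (q.2 w' 2 - q.2 w' 0) : ℂ)) * (1 - (Circle.exp (q.2 w' 2 - q.2 w' 1) : ℂ)))))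
      (ν, p) := by
  have hmem : (ν, p) ∈ {q : ℝ × (W → Fin 3 → ℝ) | ∀ w' ∈ S, w' ≠ w → q.2 w' 0 ≠ 0} := fun w' hw' _ => hp.2.2.2 w' hw'
  exact (contDiffOn_wallFactorR_uncurry S w).contDiffAt ((isOpen_setOf_forall_mem_snd_apply_ne_zero S w).mem_nhds hmem)

end Joint

end Literature.NumberTheory.Rogawski1990

end
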